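import Mathlib
import Literature.Combinatorics.Optimization.TracialDesigns
import HarnessLib

/-!
# Cell pnp-psdrank, route `ChebyshevTracialDesign`: INTERPOLATION PRICING — what an exact design with exactly `D+1`
# nodes does to a profile of ANY degree, and the exact positive leak of the first unpriced degree

Engine brick (eng g11, MEMO-11 §2). An exact extrapolation design of degree `D` on the levels `C`
(`Σ_{c∈C} w_c p(c) = −p(0)` for every real polynomial `p` of degree `≤ D`, the exactness clause of
`Literature.Combinatorics.Optimization.IsExactDesign`) prices every level profile `Φ` whose restriction to `C` is a
polynomial of degree `≤ D` at its virtual value `−Φ(0)`. The typed designs of the route (`ChebyshevDesign20`'s witness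
`C = {3 + 4sj² : j ≤ D}`, the cell's Lobatto designs) have EXACTLY `D+1` nodes, and then the design is the vector of
(minus the) Lagrange extrapolation coefficients to `0`, so it prices EVERY function through its interpolant:

* §1 `design_sum_eq_neg_interpolate_eval_zero`: `#C = D+1` ⇒ for every `f : ℕ → ℝ`,
  `Σ_{c∈C} w_c f(c) = −(Lagrange interpolant of f at the nodes C)(0)`.
* §2 `design_sum_of_natDegree_le_succ`: for a polynomial `P` of degree `≤ D+1` (one degree above exactness),
  `Σ_{c∈C} w_c P(c) = −P(0) + lc_{D+1}(P) · Π_{c∈C} (−c)` — the first unpriced degree leaks exactly its leading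
  coefficient times the nodal polynomial at `0`.
* §3 `design_sum_sqSlack_pochhammer`: the instance behind the engine's calibration of the tightness-free reweighted
  design `W̃ = W·(cc−1)²` (prover g9 `…UnconstrainedSquareSlack`): for `D ≥ 2`,
  `Σ_{c∈C} w_c (c−1)² Π_{i<D−1} (c−i) = Π_{c∈C} (−c)`, which is `> 0` when `D` is odd and the nodes are positive
  (`design_sum_sqSlack_pochhammer_pos`). Since the level profile of the `k`-crossing-pin junta rectangle is
  `κ_k·Π_{i<k}(c−i)` with `κ_k > 0` (cell N1 pattern law; eng MEMO-11 §2 brute-force check), the `(D−1)`-pin junta has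
  W̃-value exactly `+κ_{D−1}·Π_{c∈C} c` under every `(D+1)`-node design of odd degree `D`: the W̃ functional is NOT
  nonpositive on juntas one degree above its exactness, by an explicit `n^{−2(D−1)}`-size amount — consistent with the
  necessary condition NTF (`≤ m³e^{−a·dq n}`) only because `n^{−2D} ≪ e^{−aD}`.
[cite: CoppersmithRivlin1992, Thm. (p. 970)] [cite: Rothvoss2017, §2 (PDF p. 6, eq. (2))]
Stature: support/instrument. WHAT THIS IS NOT: no statement about rectangles or psd strategies is proved here (the junta
profile law is quoted, not used); nothing on psd rank of P_PM; no P-vs-NP content.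
-/

set_option linter.dupNamespace false -- `Summit.PneNP.PneNP.…`: summit = sub-problem (D-0017)

noncomputable section

namespace Summit.PneNP.PneNP.Theorems.ChebyshevTracialDesignInterpolationPricing

open Finset Polynomial Lagrange

/-- The cast `ℕ → ℝ` is injective on any set of nodes. -/
theorem cast_injOn (C : Finset ℕ) : Set.InjOn (fun c : ℕ => (c : ℝ)) (C : Set ℕ) :=
  fun _ _ _ _ h => Nat.cast_injective h

/-! ### §1 With exactly `D+1` nodes the design prices every function through its interpolant -/

/-- **Interpolation pricing.** If `Σ_{c∈C} w_c p(c) = −p(0)` for all real polynomials of degree `≤ D` and `#C = D+1`, then for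
EVERY function `f` on the levels, `Σ_{c∈C} w_c f(c) = −(interpolant of f at C)(0)`.
[cite: CoppersmithRivlin1992, Thm. (p. 970)] -/
theorem design_sum_eq_neg_interpolate_eval_zero {D : ℕ} {C : Finset ℕ} {w : ℕ → ℝ}
    (hex : ∀ p : Polynomial ℝ, p.natDegree ≤ D → ∑ c ∈ C, w c * p.eval (c : ℝ) = -p.eval 0)
    (hcard : C.card = D + 1) (f : ℕ → ℝ) :
    ∑ c ∈ C, w c * f c = -(interpolate C (fun c : ℕ => (c : ℝ)) f).eval 0 := by
  set q : Polynomial ℝ := interpolate C (fun c : ℕ => (c : ℝ)) f with hq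
  have hdeg : q.natDegree ≤ D := by
    have h : q.degree < ((D + 1 : ℕ) : WithBot ℕ) := by
      have h := degree_interpolate_lt f (cast_injOn C)
      rwa [hcard] at h
    rw [degree_lt_iff_coeff_zero] at h
    exact natDegree_le_iff_coeff_eq_zero.2 fun N hN => h N (Nat.succ_le_of_lt hN)
  have hnode : ∀ c ∈ C, q.eval (c : ℝ) = f c := fun c hc => by
    rw [hq]; exact eval_interpolate_at_node f (cast_injOn C) hc
  calc ∑ c ∈ C, w c * f c = ∑ c ∈ C, w c * q.eval (c : ℝ) := sum_congr rfl fun c hc => by rw [hnode c hc]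
    _ = -q.eval 0 := hex q hdeg

/-! ### §2 One degree above exactness: the leak is the leading coefficient times the nodal polynomial at `0` -/

/-- For `P` of degree `≤ #C`: `P − lc·nodal` (with `lc` the coefficient of `X^{#C}`) is the interpolant of `P` at the nodes. -/
theorem sub_nodal_eq_interpolate (C : Finset ℕ) (P : Polynomial ℝ) (hP : P.natDegree ≤ C.card) :
    P - Polynomial.C (P.coeff C.card) * nodal C (fun c : ℕ => (c : ℝ)) =
      interpolate C (fun c : ℕ => (c : ℝ)) (fun c => P.eval (c : ℝ)) := by
  have hnod1 : (nodal C (fun c : ℕ => (c : ℝ))).coeff C.card = 1 := by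
    have hmon := nodal_monic (s := C) (v := fun c : ℕ => (c : ℝ))
    have h := hmon.coeff_natDegree
    rwa [natDegree_nodal] at h
  have hdegQ : (P - Polynomial.C (P.coeff C.card) * nodal C (fun c : ℕ => (c : ℝ))).degree < C.card := by
    refine (degree_lt_iff_coeff_zero _ _).2 fun m hm => ?_
    rw [coeff_sub, coeff_C_mul]
    rcases hm.lt_or_eq with hlt | heq
    · have h1 : P.coeff m = 0 := coeff_eq_zero_of_natDegree_lt (lt_of_le_of_lt hP hlt)
      have h2 : (nodal C (fun c : ℕ => (c : ℝ))).coeff m = 0 :=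
        coeff_eq_zero_of_natDegree_lt (by rw [natDegree_nodal]; exact hlt)
      rw [h1, h2, mul_zero, sub_zero]
    · rw [← heq, hnod1, mul_one, sub_self]
  refine eq_interpolate_of_eval_eq (fun c : ℕ => P.eval (c : ℝ)) (cast_injOn C) hdegQ ?_
  intro c hc
  rw [eval_sub, eval_mul, eval_C, eval_nodal_at_node hc, mul_zero, sub_zero]

/-- **First unpriced degree.** If `Σ_{c∈C} w_c p(c) = −p(0)` for all `p` of degree `≤ D` and `#C = D+1`, then for every
polynomial `P` of degree `≤ D+1`:  `Σ_{c∈C} w_c P(c) = −P(0) + P.coeff(D+1) · Π_{c∈C} (−c)`.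
[cite: CoppersmithRivlin1992, Thm. (p. 970)] -/
theorem design_sum_of_natDegree_le_succ {D : ℕ} {C : Finset ℕ} {w : ℕ → ℝ}
    (hex : ∀ p : Polynomial ℝ, p.natDegree ≤ D → ∑ c ∈ C, w c * p.eval (c : ℝ) = -p.eval 0)
    (hcard : C.card = D + 1) (P : Polynomial ℝ) (hP : P.natDegree ≤ D + 1) :
    ∑ c ∈ C, w c * P.eval (c : ℝ) = -P.eval 0 + P.coeff (D + 1) * ∏ c ∈ C, (-(c : ℝ)) := by
  have hI := design_sum_eq_neg_interpolate_eval_zero hex hcard (fun c => P.eval (c : ℝ))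
  have hQ := sub_nodal_eq_interpolate C P (by rw [hcard]; exact hP)
  rw [hI, ← hQ, eval_sub, eval_mul, eval_C, eval_nodal, hcard]
  simp only [zero_sub]
  ring

/-! ### §3 The instance for `W̃ = W·(cc−1)²`: the `(D−1)`-pin leak -/

/-- The test polynomial `(X−1)²·Π_{i<k}(X−i)`: monic of degree `k+2`, vanishing at `0` when `k ≥ 1`. -/
theorem natDegree_sqSlack_pochhammer (k : ℕ) :
    ((X - Polynomial.C (1 : ℝ)) ^ 2 * ∏ i ∈ range k, (X - Polynomial.C (i : ℝ))).natDegree = k + 2 ∧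
    ((X - Polynomial.C (1 : ℝ)) ^ 2 * ∏ i ∈ range k, (X - Polynomial.C (i : ℝ))).Monic := by
  have hm1 : ((X - Polynomial.C (1 : ℝ)) ^ 2).Monic := (monic_X_sub_C 1).pow 2
  have hm2 : (∏ i ∈ range k, (X - Polynomial.C (i : ℝ))).Monic := monic_prod_of_monic _ _ fun i _ => monic_X_sub_C _
  refine ⟨?_, hm1.mul hm2⟩
  have h1 : ((X - Polynomial.C (1 : ℝ)) ^ 2).natDegree = 2 := by
    rw [(monic_X_sub_C (1 : ℝ)).natDegree_pow, natDegree_X_sub_C]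
  have h2 : (∏ i ∈ range k, (X - Polynomial.C (i : ℝ))).natDegree = k := by
    rw [natDegree_prod_of_monic _ _ fun i _ => monic_X_sub_C _]
    simp only [natDegree_X_sub_C, sum_const, card_range, smul_eq_mul, mul_one]
  rw [hm1.natDegree_mul hm2, h1, h2]; ring

/-- **The square-slack Pochhammer identity.** For an exact design of degree `D ≥ 2` with exactly `D+1` nodes:
`Σ_{c∈C} w_c (c−1)² Π_{i<D−1}(c−i) = Π_{c∈C} (−c)`. [cite: CoppersmithRivlin1992, Thm. (p. 970)] -/
theorem design_sum_sqSlack_pochhammer {D : ℕ} (hD : 2 ≤ D) {C : Finset ℕ} {w : ℕ → ℝ}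
    (hex : ∀ p : Polynomial ℝ, p.natDegree ≤ D → ∑ c ∈ C, w c * p.eval (c : ℝ) = -p.eval 0)
    (hcard : C.card = D + 1) :
    ∑ c ∈ C, w c * (((c : ℝ) - 1) ^ 2 * ∏ i ∈ range (D - 1), ((c : ℝ) - i)) = ∏ c ∈ C, (-(c : ℝ)) := by
  obtain ⟨hdeg, hmon⟩ := natDegree_sqSlack_pochhammer (D - 1)
  set P : Polynomial ℝ := (X - Polynomial.C (1 : ℝ)) ^ 2 * ∏ i ∈ range (D - 1), (X - Polynomial.C (i : ℝ)) with hP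
  have hdeg' : P.natDegree = D + 1 := by rw [hdeg]; omega
  have heval : ∀ x : ℝ, P.eval x = (x - 1) ^ 2 * ∏ i ∈ range (D - 1), (x - i) := fun x => by
    rw [hP, eval_mul, eval_pow, eval_sub, eval_X, eval_C, eval_prod]
    simp only [eval_sub, eval_X, eval_C]
  have h0 : P.eval 0 = 0 := by
    rw [heval]
    have : (0 : ℕ) ∈ range (D - 1) := mem_range.2 (by omega)
    rw [prod_eq_zero this (by simp), mul_zero]
  have hlc : P.coeff (D + 1) = 1 := by
    have h := hmon.coeff_natDegree
    rwa [hdeg'] at h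
  have h := design_sum_of_natDegree_le_succ hex hcard P hdeg'.le
  rw [h0, hlc, neg_zero, zero_add, one_mul] at h
  rw [← h]
  exact sum_congr rfl fun c _ => by rw [heval]

/-- **Positivity of the leak for odd `D` and positive nodes**: `Σ_{c∈C} w_c (c−1)² Π_{i<D−1}(c−i) = Π_{c∈C} c > 0`.
(For the route's designs the nodes are odd levels `≥ 3`.) -/
theorem design_sum_sqSlack_pochhammer_pos {D : ℕ} (hD : 2 ≤ D) (hodd : Odd D) {C : Finset ℕ} {w : ℕ → ℝ}
    (hex : ∀ p : Polynomial ℝ, p.natDegree ≤ D → ∑ c ∈ C, w c * p.eval (c : ℝ) = -p.eval 0)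
    (hcard : C.card = D + 1) (hpos : ∀ c ∈ C, 0 < c) :
    ∑ c ∈ C, w c * (((c : ℝ) - 1) ^ 2 * ∏ i ∈ range (D - 1), ((c : ℝ) - i)) = ∏ c ∈ C, (c : ℝ) ∧
      0 < ∑ c ∈ C, w c * (((c : ℝ) - 1) ^ 2 * ∏ i ∈ range (D - 1), ((c : ℝ) - i)) := by
  have h := design_sum_sqSlack_pochhammer hD hex hcard
  have heven : Even (D + 1) := hodd.add_one
  have hprod : ∏ c ∈ C, (-(c : ℝ)) = ∏ c ∈ C, (c : ℝ) := by
    rw [Finset.prod_neg, hcard, heven.neg_one_pow, one_mul]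
  rw [h, hprod]
  exact ⟨rfl, prod_pos fun c hc => by exact_mod_cast hpos c hc⟩

/-- The same for the route's exact designs: `IsExactDesign n t T D B C w` with `#C = D + 1`, `D ≥ 2` odd ⇒ the
`(D−1)`-pin test polynomial of `W̃` is priced at `+Π_{c∈C} c > 0`. [cite: Rothvoss2017, §2 (PDF p. 6, eq. (2))] -/
theorem isExactDesign_sqSlack_pochhammer_pos {n t T D : ℕ} {B : ℝ} {C : Finset ℕ} {w : ℕ → ℝ}
    (hdes : Literature.Combinatorics.Optimization.IsExactDesign n t T D B C w) (hD : 2 ≤ D) (hodd : Odd D)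
    (hcard : C.card = D + 1) :
    ∑ c ∈ C, w c * (((c : ℝ) - 1) ^ 2 * ∏ i ∈ range (D - 1), ((c : ℝ) - i)) = ∏ c ∈ C, (c : ℝ) ∧
      0 < ∏ c ∈ C, (c : ℝ) := by
  obtain ⟨-, -, -, hC, -, hex, -⟩ := hdes
  have hpos : ∀ c ∈ C, 0 < c := fun c hc => by have := (hC c hc).2.1; omega
  obtain ⟨h1, h2⟩ := design_sum_sqSlack_pochhammer_pos hD hodd hex hcard hpos
  exact ⟨h1, h1 ▸ h2⟩

/-! ### §4 The simple-zero shape: the design value of the profile `(c−1)²/c`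

Eng MEMO-11 §5(e): a tight strategy obtained by tensoring the slack factor (`cc − 1`) with a unit-vector kernel whose mean square on
level `c` is `κ/c` (the variance of an AVERAGE of `c` signs) has level profile `∝ (c−1)²/c = c − 2 + 1/c`, which an exact design with
exactly `D+1` nodes prices at `2 − Σ_{c∈C} 1/c` — POSITIVE (i.e. a violation of decay, up to the normalisation) whenever the nodes are
spread enough that `Σ_{c∈C} 1/c < 2` (always the case for the route's Chebyshev nodes `3 + 4sj²`). The kernel fact is elementary:
`Σ_c w_c/c = −Σ_{c∈C} 1/c`, because the interpolant of `1/x` at the nodes is `(1 − Π_{c∈C}(1 − x/c))/x`, whose value at `0` is `Σ 1/c`. -/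

/-- The polynomial `Π_{c∈C} (1 − x/c)`: constant coefficient `1`, coefficient of `x` equal to `−Σ_{c∈C} 1/c`. -/
theorem prod_one_sub_div_coeff (C : Finset ℕ) :
    (∏ c ∈ C, (1 - Polynomial.C ((c : ℝ)⁻¹) * X)).coeff 0 = 1 ∧
      (∏ c ∈ C, (1 - Polynomial.C ((c : ℝ)⁻¹) * X)).coeff 1 = -∑ c ∈ C, ((c : ℝ))⁻¹ := by
  classical
  induction C using Finset.induction_on with
  | empty => simp [coeff_one]
  | insert a s ha ih =>
    obtain ⟨h0, h1⟩ := ih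
    rw [prod_insert ha, sum_insert ha]
    have f0 : (1 - Polynomial.C ((a : ℝ)⁻¹) * X).coeff 0 = 1 := by
      simp
    have f1 : (1 - Polynomial.C ((a : ℝ)⁻¹) * X).coeff 1 = -((a : ℝ))⁻¹ := by
      simp [coeff_one]
    refine ⟨by rw [mul_coeff_zero, f0, h0, mul_one], ?_⟩
    rw [coeff_mul, Finset.Nat.antidiagonal_succ, Finset.sum_cons, Finset.Nat.antidiagonal_zero, Finset.map_singleton,
      Finset.sum_singleton]
    simp only [Function.Embedding.coe_prodMap, Function.Embedding.coeFn_mk, Prod.map_apply, Nat.succ_eq_add_one,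
      Function.Embedding.refl_apply, zero_add]
    rw [f0, h1, f1, h0]
    ring

/-- The same polynomial vanishes at every (nonzero) node. -/
theorem prod_one_sub_div_eval_node (C : Finset ℕ) {c : ℕ} (hc : c ∈ C) (hc0 : c ≠ 0) :
    (∏ d ∈ C, (1 - Polynomial.C ((d : ℝ)⁻¹) * X)).eval (c : ℝ) = 0 := by
  rw [eval_prod]
  refine prod_eq_zero hc ?_
  have h : (c : ℝ) ≠ 0 := by exact_mod_cast hc0
  simp [h]

/-- **The design value of `1/c`**: for an exact design of degree `D` with exactly `D+1` nonzero nodes, `Σ_{c∈C} w_c/c = −Σ_{c∈C} 1/c`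
(interpolation pricing of `f(c) = 1/c`; its interpolant is `(1 − Π_{c∈C}(1 − x/c))/x`). [cite: CoppersmithRivlin1992, Thm. (p. 970)] -/
theorem design_sum_inv {D : ℕ} {C : Finset ℕ} {w : ℕ → ℝ}
    (hex : ∀ p : Polynomial ℝ, p.natDegree ≤ D → ∑ c ∈ C, w c * p.eval (c : ℝ) = -p.eval 0)
    (hcard : C.card = D + 1) (hC : ∀ c ∈ C, c ≠ 0) :
    ∑ c ∈ C, w c * ((c : ℝ))⁻¹ = -∑ c ∈ C, ((c : ℝ))⁻¹ := by
  obtain ⟨hR0, hR1⟩ := prod_one_sub_div_coeff C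
  have hRnode : ∀ c ∈ C, (∏ d ∈ C, (1 - Polynomial.C ((d : ℝ)⁻¹) * X)).eval (c : ℝ) = 0 :=
    fun c hc => prod_one_sub_div_eval_node C hc (hC c hc)
  set R : Polynomial ℝ := ∏ c ∈ C, (1 - Polynomial.C ((c : ℝ)⁻¹) * X) with hR
  set P : Polynomial ℝ := divX (1 - R) with hP
  -- `1 - R = X * P` (its constant coefficient vanishes)
  have hsplit : X * P = 1 - R := by
    have h := X_mul_divX_add (1 - R)
    have h0 : (1 - R).coeff 0 = 0 := by rw [coeff_sub, coeff_one_zero, hR0, sub_self]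
    rwa [h0, map_zero, add_zero] at h
  -- degree of `P`
  have hdegR : R.natDegree ≤ D + 1 := by
    rw [hR]
    refine (natDegree_prod_le _ _).trans ?_
    rw [← hcard, Finset.card_eq_sum_ones]
    refine sum_le_sum fun c _ => ?_
    refine (natDegree_sub_le _ _).trans ?_
    rw [natDegree_one, Nat.zero_max]
    refine (natDegree_C_mul_le _ _).trans ?_
    rw [natDegree_X]
  have hdegP : P.natDegree ≤ D := by
    rw [hP, natDegree_divX_eq_natDegree_tsub_one]
    have : (1 - R).natDegree ≤ D + 1 := (natDegree_sub_le _ _).trans (by rw [natDegree_one, Nat.zero_max]; exact hdegR)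
    omega
  -- values of `P` at the nodes and at `0`
  have hnode : ∀ c ∈ C, P.eval (c : ℝ) = ((c : ℝ))⁻¹ := fun c hc => by
    have h := congrArg (fun q => q.eval (c : ℝ)) hsplit
    simp only [eval_mul, eval_X, eval_sub, eval_one] at h
    rw [hRnode c hc, sub_zero] at h
    have hc0 : (c : ℝ) ≠ 0 := by exact_mod_cast hC c hc
    field_simp
    linarith [h]
  have hzero : P.eval 0 = ∑ c ∈ C, ((c : ℝ))⁻¹ := by
    rw [← coeff_zero_eq_eval_zero, hP, coeff_divX, zero_add, coeff_sub, hR1]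
    simp [coeff_one]
  have h := hex P hdegP
  rw [hzero] at h
  rw [← h]
  exact sum_congr rfl fun c hc => by rw [hnode c hc]

/-- **The simple-zero shape is priced at `2 − Σ 1/c`**: for an exact design of degree `D ≥ 1` with exactly `D+1` nonzero nodes,
`Σ_{c∈C} w_c·(c−1)²/c = 2 − Σ_{c∈C} 1/c`; in particular it is POSITIVE as soon as `Σ_{c∈C} 1/c < 2`.
[cite: CoppersmithRivlin1992, Thm. (p. 970)] [cite: Rothvoss2017, §2 (PDF p. 6, eq. (2))] -/
theorem design_sum_sqSlack_div {D : ℕ} (hD : 1 ≤ D) {C : Finset ℕ} {w : ℕ → ℝ}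
    (hex : ∀ p : Polynomial ℝ, p.natDegree ≤ D → ∑ c ∈ C, w c * p.eval (c : ℝ) = -p.eval 0)
    (hcard : C.card = D + 1) (hC : ∀ c ∈ C, c ≠ 0) :
    ∑ c ∈ C, w c * (((c : ℝ) - 1) ^ 2 / c) = 2 - ∑ c ∈ C, ((c : ℝ))⁻¹ ∧
      (∑ c ∈ C, ((c : ℝ))⁻¹ < 2 → 0 < ∑ c ∈ C, w c * (((c : ℝ) - 1) ^ 2 / c)) := by
  have hsum1 : ∑ c ∈ C, w c = -1 := by
    have h := hex (Polynomial.C 1) (by rw [natDegree_C]; exact Nat.zero_le _)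
    simpa using h
  have hsumX : ∑ c ∈ C, w c * (c : ℝ) = 0 := by
    have h := hex X (by rw [natDegree_X]; exact hD)
    simpa using h
  have hinv := design_sum_inv hex hcard hC
  have key : ∑ c ∈ C, w c * (((c : ℝ) - 1) ^ 2 / c) =
      ∑ c ∈ C, w c * (c : ℝ) - 2 * ∑ c ∈ C, w c + ∑ c ∈ C, w c * ((c : ℝ))⁻¹ := by
    rw [mul_sum, ← sum_sub_distrib, ← sum_add_distrib]
    refine sum_congr rfl fun c hc => ?_
    have hc0 : (c : ℝ) ≠ 0 := by exact_mod_cast hC c hc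
    field_simp
    ring
  have hval : ∑ c ∈ C, w c * (((c : ℝ) - 1) ^ 2 / c) = 2 - ∑ c ∈ C, ((c : ℝ))⁻¹ := by
    rw [key, hsumX, hsum1, hinv]; ring
  exact ⟨hval, fun hlt => by rw [hval]; linarith⟩

end Summit.PneNP.PneNP.Theorems.ChebyshevTracialDesignInterpolationPricing
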